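import Mathlib
import Summits.BirchSwinnertonDyer.BirchSwinnertonDyer.Theorems.ManinLocalTwoThreeTwoDvdModularDegreeOfAtkinLehnerInvariant
import Literature.NumberTheory.EllipticCurves.CuspFormLFunctionFrickeProofs
import Literature.NumberTheory.EllipticCurves.AtkinLehnerFrickeLevelProofs
import Literature.NumberTheory.EllipticCurves.ModularSymbolsCompletedLProofs
import Literature.NumberTheory.EllipticCurves.QuadraticTwistLDerivativeSeries
import Literature.NumberTheory.EllipticCurves.NoConductorOne
import HarnessLib

/-!
# `w_N f = f` (Fricke sign `+1`, root number `−1`) ⟹ every modular parametrisation by `f` has EVEN degree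

Summit `BirchSwinnertonDyer`, sub-problem `BirchSwinnertonDyer`, route `ManinLocalTwoThree`; width seat `bsd-line-manin23-p2`
(gen 9), `--supports` the crux C2 `ManinOddAtFour` (stmt-BirchSwinnertonDyer-22967).  Cell `bsd-f2-manin` (an/es parity
programme at `2`: the print floor «odd modular degree ⟹ analytic rank even» is Calegari–Emerton's Theorem 1 clause; here the
elementary half in the kernel): the case `Q = N` of the seat's `two_dvd_modularDegree_of_atkinLehnerW_invariant` (p657513).  If
`w_N f = f` then the Hecke functional equation (`exists_completedCuspFormL_functional_equation_holds`,
`exists_functional_equation_of_frickeInvolution_eq_smul`) reads `Λ(s) = −Λ(2 − s)`, so `Λ(1) = 0` and `{∞, 0}_f = 0`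
(`modularSymbol_zero_eq_of_mem_completedCuspFormLContinuations`); the cusp `w(N)∞ = x ∈ ℤ` has symbol `{∞, x}_f = {∞, 0}_f = 0`
(`modularSymbol_add_intCast`), so `φ_D(w(N)∞) = O` and `φ_D ∘ w(N) = φ_D`; the involution `w(N)` of `Y₀(N)` has countably many
fixed orbits (`N ≠ 1`), hence `2 ∣ deg φ_D`.

PROVED here (no `sorry`): `modularSymbol_zero_eq_zero_of_frickeInvolution_eq_self` (`w_N f = f ⟹ {∞,0}_f = 0`, any `f ∈ S₂(Γ₀(N))`),
**`two_dvd_modularDegree_of_frickeInvolution_eq_self`** (any datum `D` at level `N ≠ 1` with `w_N f_D = f_D`),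
**`two_dvd_modularDegree_of_rootNumber_eq_neg_one`** (E-facing: data at the conductor of a globally minimal curve with root number `−1`).
BSD is not proved by this; Manin's conjecture is not proved by this.
-/

set_option autoImplicit false
set_option linter.dupNamespace false

noncomputable section

open scoped MatrixGroups ModularForm
open CongruenceSubgroup Matrix.SpecialLinearGroup UpperHalfPlane
open Literature.NumberTheory.EllipticCurves Literature.NumberTheory.EllipticCurves.ModularForms
open Summit.BirchSwinnertonDyer.Rank1Residual.ManinAdditive

namespace Summit.BirchSwinnertonDyer.BirchSwinnertonDyer.Theorems.ManinLocalTwoThree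

variable {N : ℕ} [NeZero N]

/-- **`w_N f = f ⟹ {∞, 0}_f = 0`** for every `f ∈ S₂(Γ₀(N))`: the functional equation `Λ(s) = i² ε Λ(2 − s)` with `ε = 1`
forces `Λ(1) = 0`, and `{∞,0}_f = (2π/√N) Λ(1)`. -/
theorem modularSymbol_zero_eq_zero_of_frickeInvolution_eq_self {f : CuspForm (Gamma0 N) 2}
    (hf : frickeInvolution N 2 f = f) : modularSymbol f 0 = 0 := by
  have hf' : frickeInvolution N 2 f = (1 : ℂ) • f := by rw [one_smul]; exact hf
  obtain ⟨Λ, hΛ, hfe⟩ := exists_functional_equation_of_frickeInvolution_eq_smul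
    (exists_completedCuspFormL_functional_equation_holds (N := N) 2) hf'
  have h1 : Λ 1 = 0 := by
    have h := hfe 1
    rw [show ((2 : ℤ) : ℂ) - 1 = 1 by norm_num, mul_one, show Complex.I ^ (2 : ℤ) = -1 by
      rw [zpow_two, Complex.I_mul_I]] at h
    linear_combination h / 2
  rw [modularSymbol_zero_eq_of_mem_completedCuspFormLContinuations_holds f hΛ, h1, mul_zero]

/-- **`w_N f_D = f_D ⟹ 2 ∣ deg φ_D`** for every modular parametrisation datum at a level `N ≠ 1` (Fricke sign `+1`, i.e. root
number `−1`): `φ_D` is `w(N)`-invariant (`{∞, w(N)∞}_f = {∞,0}_f = 0`) and the involution `w(N)` of `Y₀(N)` acts freely on a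
generic fibre. -/
theorem two_dvd_modularDegree_of_frickeInvolution_eq_self (hN1 : N ≠ 1) {W : WeierstrassCurve ℚ} [W.IsElliptic]
    (D : ModularParametrizationData W N) (hf : frickeInvolution N 2 D.f = D.f) : 2 ∣ D.modularDegree := by
  have hc : Nat.Coprime N (N / N) := by rw [Nat.div_self (NeZero.pos N)]; exact Nat.coprime_one_right N
  have hε : atkinLehnerInvolution N 2 N D.f = D.f := by rw [atkinLehnerInvolution_self_eq_frickeInvolution]; exact hf
  refine two_dvd_modularDegree_of_atkinLehnerW_invariant dvd_rfl hc hN1 D hε ?_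
  -- the cusp `w(N)∞ = x/(N/N) = x ∈ ℤ` has symbol `{∞, x} = {∞, 0} = 0`
  have hx : modularSymbol D.f ((atkinLehnerSL N N 0 0 : ℚ) / (N / N : ℕ)) = 0 := by
    rw [Nat.div_self (NeZero.pos N), Nat.cast_one, div_one,
      show ((atkinLehnerSL N N 0 0 : ℤ) : ℚ) = (0 : ℚ) + ((atkinLehnerSL N N 0 0 : ℤ) : ℚ) by ring,
      modularSymbol_add_intCast_holds D.f 0 _, modularSymbol_zero_eq_zero_of_frickeInvolution_eq_self hf]
  rw [hx, mul_zero, map_zero]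

/-- **E-facing: root number `−1` ⟹ even modular degree.**  For an elliptic `W/ℚ` with `w(W) = −1` and any modular
parametrisation datum `D` at its conductor, `2 ∣ deg φ_D` (the Fricke sign of `f_W` is `+1`,
`frickeInvolution_eq_self_of_rootNumber_eq_neg_one`). -/
theorem two_dvd_modularDegree_of_rootNumber_eq_neg_one (W : WeierstrassCurve ℚ) [W.IsElliptic] [W.IsGloballyMinimal]
    [NeZero (W.conductorNorm ℤ)]
    (D : ModularParametrizationData W (W.conductorNorm ℤ)) (hw : W.rootNumber = -1) : 2 ∣ D.modularDegree := by
  have hN1 : W.conductorNorm ℤ ≠ 1 := W.conductorNorm_ne_one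
  exact two_dvd_modularDegree_of_frickeInvolution_eq_self hN1 D
    (frickeInvolution_eq_self_of_rootNumber_eq_neg_one W D.isNewformOf hw)

end Summit.BirchSwinnertonDyer.BirchSwinnertonDyer.Theorems.ManinLocalTwoThree

end
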